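import Summits.Parity.GeneralizedHardyLittlewood.Theorems.LiouvilleShiftedTablesTypeI2DilatedURB1
import Summits.Parity.GeneralizedHardyLittlewood.Theorems.TypeI2Dilated.Negative.LogPowerBias
import Literature.NumberTheory.Sieve.HeathBrownIdentityLiouville
import Literature.NumberTheory.Sieve.DivisorBound

/-!
# The `𝔲_R` terms of the assembly (`stub_uRBound`), file 2: numerics, the small-mass lemma, the squares tail

Route `LiouvilleShiftedTables` (Parity / GeneralizedHardyLittlewood), crux `TypeI2Dilated` (stmt-Parity-14272), line
`peel-to-drappeau`, registered stub `stub_uRBound : URBound`; continuation of `…URB1` (the functional `NS(a) = normSum`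
and its trivial bound, Step T).

* Numerics used throughout the chain: `K (log x)^n ≤ x^ε` and `K ≤ x^ε` for large `x`
  (`eventually_mul_log_pow_le`, `eventually_le_rpow`); `Ψ₁(S) = ∑_{s ≤ S} τ(s)/φ(s) ≤ C (log x)^8` for `S ≤ x`
  (`psiOne_mono`, `exists_psiOne_le`).
* THE SMALL-MASS LEMMA (`normSum_le_of_mass`): in the regime of `URBound` (`P R ≤ x^{4ρ}`, `2 Slo R P ≤ x^{1/2+ρ}`,
  `R ≥ 1`, `Y ≤ 2x`), a sequence with `∑_{m ≤ Y} |a(m)| ≤ x^{1−53ρ}` and `∑_{m ≤ Y, m = c} |a(m)| ≤ T_c` has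
  `NS(a) ≤ x^{1−6ρ}` for `x ≥ x₀(ρ, c, T_c)` — Step T with the divisor bound `τ(n) ≤ C_ρ n^ρ` and `Ψ₁ ≤ C (log x)^8`.
* Step S (`urb_tail`): the squares tail `(1_{□,>K} ⋆ μ)`, `K = ⌊x^{60ρ}⌋²`, has mass `≤ 2x/⌊x^{60ρ}⌋ ≤ 4x^{1−60ρ}`
  on `[1, 2x]` (`HeathBrownLiouville.sum_abs_sqIndGt_mul_moebius_le` and `∑_{b > B} 1/b² ≤ 1/B`,
  `sum_Ioc_inv_sq_le`) and values `≤ τ`, hence `NS ≤ x^{1−6ρ}`.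
[this line: Lines/peel-to-drappeau.md; cite: Drappeau2017, §6; Heathbrown1982, Lemma 1]
-/

noncomputable section

namespace Summit.Parity.GeneralizedHardyLittlewood.Cruxes.TypeI2Dilated.PeelToDrappeau

open Finset Real Filter
open scoped ArithmeticFunction.sigma ArithmeticFunction.Moebius Classical
open Literature.NumberTheory.Sieve Literature.NumberTheory.Sieve.Drappeau2017

/-! ### Numerics: powers of `log x` and constants against `x^ε` -/

/-- `K (log x)^n ≤ x^ε` for all large `x` (`ε > 0`). [folklore] -/
theorem eventually_mul_log_pow_le (K : ℝ) (n : ℕ) {ε : ℝ} (hε : 0 < ε) :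
    ∀ᶠ x : ℝ in atTop, K * Real.log x ^ n ≤ x ^ ε := by
  rcases le_or_gt K 0 with hK | hK
  · filter_upwards [eventually_ge_atTop (1 : ℝ)] with x hx
    have h1 : 0 ≤ Real.log x ^ n := pow_nonneg (Real.log_nonneg hx) n
    have h2 : 0 ≤ x ^ ε := Real.rpow_nonneg (by linarith) ε
    nlinarith
  · obtain ⟨X, hX⟩ := Negative.exists_log_rpow_le (n : ℝ) hε (inv_pos.2 hK)
    filter_upwards [eventually_ge_atTop X] with x hx
    have h := hX x hx
    rw [Real.rpow_natCast] at h
    calc K * Real.log x ^ n ≤ K * (K⁻¹ * x ^ ε) := mul_le_mul_of_nonneg_left h hK.le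
      _ = x ^ ε := by field_simp

/-- `K ≤ x^ε` for all large `x` (`ε > 0`). [folklore] -/
theorem eventually_le_rpow (K : ℝ) {ε : ℝ} (hε : 0 < ε) : ∀ᶠ x : ℝ in atTop, K ≤ x ^ ε :=
  (tendsto_rpow_atTop hε).eventually_ge_atTop K

/-- `K x^a (log x)^n ≤ x^{a + ε}` for all large `x` (`ε > 0`). [folklore] -/
theorem eventually_mul_rpow_mul_log_pow_le (K a : ℝ) (n : ℕ) {ε : ℝ} (hε : 0 < ε) :
    ∀ᶠ x : ℝ in atTop, K * x ^ a * Real.log x ^ n ≤ x ^ (a + ε) := by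
  filter_upwards [eventually_mul_log_pow_le K n hε, eventually_gt_atTop (0 : ℝ)] with x hx hx0
  rw [Real.rpow_add hx0]
  calc K * x ^ a * Real.log x ^ n = x ^ a * (K * Real.log x ^ n) := by ring
    _ ≤ x ^ a * x ^ ε := mul_le_mul_of_nonneg_left hx (Real.rpow_nonneg hx0.le a)

/-! ### `Ψ₁` -/

/-- `Ψ₁` is monotone in its range. [this line] -/
theorem psiOne_mono {S S' : ℝ} (h : S ≤ S') : psiOne S ≤ psiOne S' := by
  unfold psiOne
  exact Finset.sum_le_sum_of_subset_of_nonneg (Finset.Icc_subset_Icc_right (Nat.floor_le_floor h))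
    fun _ _ _ => by positivity

/-- `Ψ₁(x) ≤ C (log x)^8` for `x ≥ 2`. [folklore] -/
theorem exists_psiOne_le : ∃ C : ℝ, 0 < C ∧ ∀ x : ℝ, 2 ≤ x → psiOne x ≤ C * Real.log x ^ 8 := by
  obtain ⟨C, hC, h⟩ := exists_sum_sigma_zero_pow_div_totient_le_real 1
  refine ⟨C, hC, fun x hx => ?_⟩
  have := h x hx
  unfold psiOne
  simpa using this

/-! ### The small-mass lemma -/

/-- Floors of the ranges: `⌊x^ρ⌋ ⌊R⌋ ≤ x^{5ρ}` when `R ≤ x^{4ρ}`, `x ≥ 0`. [this line] -/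
theorem floor_mul_floor_le {x ρ R : ℝ} (hx : 0 < x) (hR0 : 0 ≤ R) (hR : R ≤ x ^ (4 * ρ)) :
    (⌊x ^ ρ⌋₊ : ℝ) * (⌊R⌋₊ : ℝ) ≤ x ^ (5 * ρ) := by
  have h1 : (⌊x ^ ρ⌋₊ : ℝ) ≤ x ^ ρ := Nat.floor_le (Real.rpow_nonneg hx.le _)
  have h2 : (⌊R⌋₊ : ℝ) ≤ x ^ (4 * ρ) := (Nat.floor_le hR0).trans hR
  calc (⌊x ^ ρ⌋₊ : ℝ) * (⌊R⌋₊ : ℝ) ≤ x ^ ρ * x ^ (4 * ρ) :=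
        mul_le_mul h1 h2 (Nat.cast_nonneg _) (Real.rpow_nonneg hx.le _)
    _ = x ^ (5 * ρ) := by rw [← Real.rpow_add hx]; ring_nf

/-- **The small-mass lemma** (Step T made quantitative).  For `0 < ρ ≤ 1/100` and a constant `T_c` there is `x₀` such
that in the regime of `URBound` (`1 ≤ P`, `Y ≤ 2x`, `1 ≤ R`, `P R ≤ x^{4ρ}`, `0 ≤ Slo`, `2 Slo R P ≤ x^{1/2+ρ}`) every real
sequence `a` with `∑_{1 ≤ m ≤ Y} |a(m)| ≤ x^{1−53ρ}` and `∑_{1 ≤ m ≤ Y, m = c} |a(m)| ≤ T_c` satisfies `NS(a) ≤ x^{1−6ρ}`.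
[this line] -/
theorem normSum_le_of_mass (c : ℤ) {ρ : ℝ} (hρ : 0 < ρ) (hρ1 : ρ ≤ 1 / 100) (Tc : ℝ) :
    ∃ x₀ : ℝ, ∀ x : ℝ, x₀ ≤ x → ∀ w : ℕ, ∀ Y R Slo : ℝ, ∀ P : ℕ, 1 ≤ P → Y ≤ 2 * x → 1 ≤ R →
      (P : ℝ) * R ≤ x ^ (4 * ρ) → 0 ≤ Slo → 2 * Slo * R * P ≤ x ^ (1 / 2 + ρ) → ∀ a : ℕ → ℝ,
      ∑ m ∈ Icc 1 ⌊Y⌋₊, |a m| ≤ x ^ (1 - 53 * ρ) →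
      ∑ m ∈ (Icc 1 ⌊Y⌋₊).filter (fun m : ℕ => (m : ℤ) = c), |a m| ≤ Tc →
      normSum c w P x ρ Y R Slo a ≤ x ^ (1 - 6 * ρ) := by
  obtain ⟨Cτ, hCτ1, hCτ⟩ := exists_sigma_zero_le_mul_rpow hρ
  obtain ⟨C₁, hC₁, hΨ⟩ := exists_psiOne_le
  have hev : ∀ᶠ x : ℝ in atTop, 4 * (Cτ * 3 ^ ρ) ≤ x ^ (41 * ρ) ∧ 4 * C₁ * Real.log x ^ 8 ≤ x ^ (2 * ρ) ∧
      2 * Tc ≤ x ^ (1 / 2 - 12 * ρ) ∧ (|c| : ℝ) ≤ x ∧ 2 ≤ x := by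
    refine (eventually_le_rpow _ (by linarith)).and ((eventually_mul_log_pow_le _ 8 (by linarith)).and
      ((eventually_le_rpow _ (by linarith)).and ((eventually_ge_atTop _).and (eventually_ge_atTop _))))
  obtain ⟨x₀, hx₀⟩ := Filter.eventually_atTop.1 hev
  refine ⟨x₀, fun x hx w Y R Slo P hP hY hR hPR hSlo hSRP a hmass hTc => ?_⟩
  obtain ⟨e1, e2, e3, e4, e5⟩ := hx₀ x hx
  have hx0 : 0 < x := by linarith
  have hx1 : 1 ≤ x := by linarith
  have hP1 : (1 : ℝ) ≤ P := by exact_mod_cast hP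
  -- the ranges
  have hRle : R ≤ x ^ (4 * ρ) := le_trans (le_mul_of_one_le_left (by linarith) hP1) hPR
  have hfloor := floor_mul_floor_le (ρ := ρ) hx0 (by linarith) hRle
  have h2Slo : 2 * Slo ≤ x ^ (1 / 2 + ρ) := by
    have hRP : 1 ≤ R * P := one_le_mul_of_one_le_of_one_le hR hP1
    calc 2 * Slo ≤ 2 * Slo * (R * P) := le_mul_of_one_le_right (by linarith) hRP
      _ = 2 * Slo * R * P := by ring
      _ ≤ _ := hSRP
  have h2Slox : 2 * Slo ≤ x := by
    refine h2Slo.trans ?_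
    calc x ^ (1 / 2 + ρ) ≤ x ^ (1 : ℝ) := Real.rpow_le_rpow_of_exponent_le hx1 (by linarith)
      _ = x := Real.rpow_one x
  -- the divisor bound `D = Cτ (3x)^ρ`
  have hD : ∀ m ∈ Icc 1 ⌊Y⌋₊, (m : ℤ) ≠ c → (σ 0 (((m : ℤ) - c).natAbs) : ℝ) ≤ Cτ * (3 * x) ^ ρ := by
    intro m hm _
    rw [Finset.mem_Icc] at hm
    have hmY : (m : ℝ) ≤ 2 * x := by
      have h1 : (m : ℝ) ≤ ⌊Y⌋₊ := by exact_mod_cast hm.2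
      rcases le_or_gt 0 Y with hY0 | hY0
      · exact h1.trans ((Nat.floor_le hY0).trans hY)
      · rw [Nat.floor_of_nonpos hY0.le] at hm; omega
    have hsize : ((((m : ℤ) - c).natAbs : ℕ) : ℝ) ≤ 3 * x := by
      have h1 : ((((m : ℤ) - c).natAbs : ℕ) : ℝ) = |((m : ℝ) - (c : ℝ))| := by
        rw [Nat.cast_natAbs]; push_cast; rfl
      rw [h1]
      refine (abs_sub _ _).trans ?_
      rw [Nat.abs_cast]
      linarith
    refine (hCτ _).trans (mul_le_mul_of_nonneg_left ?_ (by linarith))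
    exact Real.rpow_le_rpow (Nat.cast_nonneg _) hsize hρ.le
  have hD0 : 0 ≤ Cτ * (3 * x) ^ ρ := by positivity
  have key := normSum_le_trivial' c w P hx0.le ρ Y R hSlo a hD0 hD
  -- `Ψ₁(2 Slo) ≤ C₁ (log x)^8`
  have hΨ₁ : psiOne (2 * Slo) ≤ C₁ * Real.log x ^ 8 := (psiOne_mono h2Slox).trans (hΨ x e5)
  have hΨ0 := psiOne_nonneg (2 * Slo)
  -- assemble
  have h3ρ : (3 * x) ^ ρ = 3 ^ ρ * x ^ ρ := Real.mul_rpow (by norm_num) hx0.le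
  have hA : Cτ * (3 * x) ^ ρ + x ^ (40 * ρ) * psiOne (2 * Slo) ≤ x ^ (42 * ρ) / 2 := by
    rw [h3ρ]
    have h1 : Cτ * (3 ^ ρ * x ^ ρ) ≤ x ^ (42 * ρ) / 4 := by
      have : x ^ (42 * ρ) = x ^ (41 * ρ) * x ^ ρ := by rw [← Real.rpow_add hx0]; ring_nf
      rw [this]
      have hxρ : 0 ≤ x ^ ρ := Real.rpow_nonneg hx0.le _
      nlinarith
    have h2 : x ^ (40 * ρ) * psiOne (2 * Slo) ≤ x ^ (42 * ρ) / 4 := by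
      have : x ^ (42 * ρ) = x ^ (40 * ρ) * x ^ (2 * ρ) := by rw [← Real.rpow_add hx0]; ring_nf
      rw [this]
      have hx40 : 0 ≤ x ^ (40 * ρ) := Real.rpow_nonneg hx0.le _
      nlinarith
    linarith
  have hB : 2 * Slo * ∑ m ∈ (Icc 1 ⌊Y⌋₊).filter (fun m : ℕ => (m : ℤ) = c), |a m| ≤
      x ^ (1 / 2 + ρ) * Tc := by
    have h0 : 0 ≤ ∑ m ∈ (Icc 1 ⌊Y⌋₊).filter (fun m : ℕ => (m : ℤ) = c), |a m| :=
      Finset.sum_nonneg fun _ _ => abs_nonneg _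
    calc _ ≤ x ^ (1 / 2 + ρ) * ∑ m ∈ (Icc 1 ⌊Y⌋₊).filter (fun m : ℕ => (m : ℤ) = c), |a m| :=
          mul_le_mul_of_nonneg_right h2Slo h0
      _ ≤ _ := mul_le_mul_of_nonneg_left hTc (Real.rpow_nonneg hx0.le _)
  have hmass0 : 0 ≤ ∑ m ∈ Icc 1 ⌊Y⌋₊, |a m| := Finset.sum_nonneg fun _ _ => abs_nonneg _
  have hTc0 : 0 ≤ Tc := le_trans (Finset.sum_nonneg fun _ _ => abs_nonneg _) hTc
  calc normSum c w P x ρ Y R Slo a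
      ≤ x ^ (5 * ρ) * ((x ^ (42 * ρ) / 2) * x ^ (1 - 53 * ρ) + x ^ (1 / 2 + ρ) * Tc) := by
        refine key.trans (mul_le_mul hfloor (add_le_add ?_ hB) ?_ (Real.rpow_nonneg hx0.le _))
        · exact mul_le_mul hA hmass (by positivity) (by positivity)
        · positivity
    _ = (x ^ (5 * ρ) * x ^ (42 * ρ) * x ^ (1 - 53 * ρ)) / 2 + x ^ (5 * ρ) * x ^ (1 / 2 + ρ) * Tc := by ring
    _ = x ^ (1 - 6 * ρ) / 2 + x ^ (1 / 2 + 6 * ρ) * Tc := by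
        rw [← Real.rpow_add hx0, ← Real.rpow_add hx0, ← Real.rpow_add hx0]; ring_nf
    _ ≤ x ^ (1 - 6 * ρ) / 2 + x ^ (1 - 6 * ρ) / 2 := by
        gcongr
        have : x ^ (1 - 6 * ρ) = x ^ (1 / 2 + 6 * ρ) * x ^ (1 / 2 - 12 * ρ) := by
          rw [← Real.rpow_add hx0]; ring_nf
        rw [this]
        have h0 : 0 ≤ x ^ (1 / 2 + 6 * ρ) := Real.rpow_nonneg hx0.le _
        nlinarith
    _ = x ^ (1 - 6 * ρ) := by ring

/-! ### Step S: the squares tail -/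

/-- The squares cutoff `K = ⌊x^{60ρ}⌋²`. [this line] -/
def urbK (x ρ : ℝ) : ℕ := ⌊x ^ (60 * ρ)⌋₊ ^ 2

/-- The squares tail `1_{□, > K} ⋆ μ`. [this line] -/
def tailLiouville (x ρ : ℝ) : ArithmeticFunction ℝ :=
  HeathBrownLiouville.sqIndGt (urbK x ρ) * (μ : ArithmeticFunction ℝ)

/-- `∑_{B < b ≤ N} 1/b² ≤ 1/B − 1/N ≤ 1/B` for `1 ≤ B ≤ N`. [folklore] -/
theorem sum_Ioc_inv_sq_le {B : ℕ} (hB : 1 ≤ B) {N : ℕ} (hN : B ≤ N) :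
    ∑ b ∈ Ioc B N, (1 : ℝ) / ((b : ℝ) ^ 2) ≤ 1 / B - 1 / N := by
  induction N, hN using Nat.le_induction with
  | base => simp
  | succ N hBN ih =>
      rw [Finset.sum_Ioc_succ_top hBN]
      have hN0 : (0 : ℝ) < N := by exact_mod_cast (lt_of_lt_of_le hB hBN)
      have h1 : (1 : ℝ) / (((N + 1 : ℕ) : ℝ) ^ 2) ≤ 1 / (N : ℝ) - 1 / ((N + 1 : ℕ) : ℝ) := by
        push_cast
        rw [div_sub_div _ _ hN0.ne' (by linarith), div_le_div_iff₀ (by positivity) (by positivity)]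
        nlinarith
      linarith

/-- The mass of the squares tail on `[1, N]`: `∑_{m ≤ N} |(1_{□,>B²} ⋆ μ)(m)| ≤ N/B` for `B ≥ 1`. [folklore] -/
theorem sum_abs_sqIndGt_mul_moebius_le' {B : ℕ} (hB : 1 ≤ B) (N : ℕ) :
    ∑ m ∈ Icc 1 N, |(HeathBrownLiouville.sqIndGt (B ^ 2) * (μ : ArithmeticFunction ℝ)) m| ≤ (N : ℝ) / B := by
  have hB0 : (0 : ℝ) < B := by exact_mod_cast hB
  rcases lt_or_ge N B with hNB | hNB
  · -- every square `> B²` exceeds `N`: the tail vanishes on `[1, N]`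
    have h := HeathBrownLiouville.sum_abs_sqIndGt_mul_moebius_le (B ^ 2) N
    rw [show Icc 1 N = Ioc 0 N from (Finset.Icc_add_one_left_eq_Ioc 0 N).symm ▸ rfl]
    refine h.trans ((Finset.sum_eq_zero fun a ha => ?_).le.trans (by positivity))
    rw [Finset.mem_Ioc] at ha
    nlinarith
  rw [show Icc 1 N = Ioc 0 N from (Finset.Icc_add_one_left_eq_Ioc 0 N).symm ▸ rfl]
  refine (HeathBrownLiouville.sum_abs_sqIndGt_mul_moebius_le (B ^ 2) N).trans ?_
  -- squares in `(B², N]` are `b²` with `B < b ≤ N`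
  have hsub : (Ioc (B ^ 2) N).filter IsSquare ⊆ (Ioc B N).image (fun b => b * b) := by
    intro n hn
    rw [Finset.mem_filter, Finset.mem_Ioc] at hn
    obtain ⟨⟨h1, h2⟩, b, rfl⟩ := hn
    refine Finset.mem_image.2 ⟨b, Finset.mem_Ioc.2 ⟨?_, ?_⟩, rfl⟩
    · by_contra hle
      push Not at hle
      have : b * b ≤ B ^ 2 := by rw [sq]; exact Nat.mul_le_mul hle hle
      omega
    · nlinarith
  calc ∑ a ∈ Ioc (B ^ 2) N, (if IsSquare a then (1 : ℝ) else 0) * ((N / a : ℕ) : ℝ)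
      = ∑ a ∈ (Ioc (B ^ 2) N).filter IsSquare, ((N / a : ℕ) : ℝ) := by
        rw [Finset.sum_filter]; exact Finset.sum_congr rfl fun a _ => by split_ifs <;> simp
    _ ≤ ∑ a ∈ (Ioc B N).image (fun b => b * b), ((N / a : ℕ) : ℝ) :=
        Finset.sum_le_sum_of_subset_of_nonneg hsub fun _ _ _ => Nat.cast_nonneg _
    _ = ∑ b ∈ Ioc B N, ((N / (b * b) : ℕ) : ℝ) := by
        rw [Finset.sum_image]
        intro b₁ _ b₂ _ h
        exact Nat.mul_self_inj.1 h
    _ ≤ ∑ b ∈ Ioc B N, (N : ℝ) * (1 / ((b : ℝ) ^ 2)) := by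
        refine Finset.sum_le_sum fun b hb => ?_
        rw [Finset.mem_Ioc] at hb
        have hb0 : (0 : ℝ) < b := by exact_mod_cast (lt_of_lt_of_le hB (by omega))
        calc ((N / (b * b) : ℕ) : ℝ) ≤ (N : ℝ) / ((b * b : ℕ) : ℝ) := Nat.cast_div_le
          _ = (N : ℝ) * (1 / ((b : ℝ) ^ 2)) := by push_cast; ring
    _ = (N : ℝ) * ∑ b ∈ Ioc B N, (1 / ((b : ℝ) ^ 2)) := (Finset.mul_sum _ _ _).symm
    _ ≤ (N : ℝ) * (1 / B - 1 / N) := mul_le_mul_of_nonneg_left (sum_Ioc_inv_sq_le hB hNB) (Nat.cast_nonneg _)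
    _ ≤ (N : ℝ) / B := by
        have hN0 : (0 : ℝ) ≤ N := Nat.cast_nonneg _
        have : (0 : ℝ) ≤ (N : ℝ) * (1 / N) := by positivity
        have h1 : (N : ℝ) * (1 / B) = N / B := by ring
        nlinarith

/-- `|(1_{□,>K} ⋆ μ)(m)| ≤ τ(m)`. [folklore] -/
theorem abs_tailLiouville_le (x ρ : ℝ) (m : ℕ) : |tailLiouville x ρ m| ≤ (σ 0 m : ℝ) := by
  have hF : ∀ d, |HeathBrownLiouville.sqIndGt (urbK x ρ) d| ≤ 1 * (σ 0 d : ℝ) ^ 0 := by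
    intro d
    rw [pow_zero, mul_one, HeathBrownLiouville.sqIndGt_apply]
    split_ifs
    · simp
    · rcases HeathBrownLiouville.sqInd_mem d with h | h <;> rw [h] <;> simp
  have hG : ∀ e, |((μ : ArithmeticFunction ℝ) e)| ≤ 1 * (σ 0 e : ℝ) ^ 0 := by
    intro e
    rw [pow_zero, mul_one, ArithmeticFunction.intCoe_apply]
    exact_mod_cast ArithmeticFunction.abs_moebius_le_one
  have := abs_mul_apply_le_sigma_zero_pow zero_le_one zero_le_one hF hG m
  simpa [tailLiouville] using this

/-- The `m = c` term of Step T for a sequence bounded by `τ^k`: `∑_{1 ≤ m ≤ Y, m = c} |a(m)| ≤ τ(|c|)^k`. [this line] -/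
theorem sum_filter_eq_le_sigma_pow {c : ℤ} {a : ℕ → ℝ} {k : ℕ} (ha : ∀ m, |a m| ≤ (σ 0 m : ℝ) ^ k) (Y : ℝ) :
    ∑ m ∈ (Icc 1 ⌊Y⌋₊).filter (fun m : ℕ => (m : ℤ) = c), |a m| ≤ (σ 0 c.natAbs : ℝ) ^ k := by
  have hsub : (Icc 1 ⌊Y⌋₊).filter (fun m : ℕ => (m : ℤ) = c) ⊆ {c.natAbs} := by
    intro m hm
    rw [Finset.mem_filter] at hm
    rw [Finset.mem_singleton, ← hm.2, Int.natAbs_natCast]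
  calc _ ≤ ∑ m ∈ ({c.natAbs} : Finset ℕ), |a m| := Finset.sum_le_sum_of_subset_of_nonneg hsub fun _ _ _ => abs_nonneg _
    _ = |a c.natAbs| := Finset.sum_singleton _ _
    _ ≤ _ := ha _

/-- **Step S — the squares tail**: `NS(1_{□,>K} ⋆ μ) ≤ x^{1−6ρ}` in the regime of `URBound`, for `0 < ρ ≤ 1/100`
and `x ≥ x₀(ρ, c)`. [this line] -/
theorem urb_tail (c : ℤ) {ρ : ℝ} (hρ : 0 < ρ) (hρ1 : ρ ≤ 1 / 100) :
    ∃ x₀ : ℝ, ∀ x : ℝ, x₀ ≤ x → ∀ w : ℕ, ∀ Y R Slo : ℝ, ∀ P : ℕ, 1 ≤ P → Y ≤ 2 * x → 1 ≤ R →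
      (P : ℝ) * R ≤ x ^ (4 * ρ) → 0 ≤ Slo → 2 * Slo * R * P ≤ x ^ (1 / 2 + ρ) →
      normSum c w P x ρ Y R Slo (fun m => tailLiouville x ρ m) ≤ x ^ (1 - 6 * ρ) := by
  obtain ⟨x₁, hx₁⟩ := normSum_le_of_mass c hρ hρ1 ((σ 0 c.natAbs : ℝ) ^ 1)
  have hev : ∀ᶠ x : ℝ in atTop, (4 : ℝ) ≤ x ^ (7 * ρ) ∧ 1 ≤ x := by
    exact (eventually_le_rpow _ (by linarith)).and (eventually_ge_atTop _)
  obtain ⟨x₂, hx₂⟩ := Filter.eventually_atTop.1 hev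
  refine ⟨max x₁ x₂, fun x hx w Y R Slo P hP hY hR hPR hSlo hSRP => ?_⟩
  obtain ⟨e1, hx1⟩ := hx₂ x ((le_max_right _ _).trans hx)
  have hx0 : 0 < x := by linarith
  refine hx₁ x ((le_max_left _ _).trans hx) w Y R Slo P hP hY hR hPR hSlo hSRP _ ?_ ?_
  · -- mass `≤ ⌊Y⌋/⌊x^{60ρ}⌋ ≤ 4 x^{1-60ρ} ≤ x^{1-53ρ}`
    set B : ℕ := ⌊x ^ (60 * ρ)⌋₊ with hBdef
    have hx60 : 1 ≤ x ^ (60 * ρ) := Real.one_le_rpow hx1 (by positivity)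
    have hB1 : 1 ≤ B := Nat.le_floor (by rw [Nat.cast_one]; exact hx60)
    have hBge : x ^ (60 * ρ) / 2 ≤ B := by
      have h := Nat.lt_floor_add_one (x ^ (60 * ρ))
      rw [← hBdef] at h
      have hB1' : (1 : ℝ) ≤ B := by exact_mod_cast hB1
      linarith
    have hmass := sum_abs_sqIndGt_mul_moebius_le' hB1 ⌊Y⌋₊
    have hYle : (⌊Y⌋₊ : ℝ) ≤ 2 * x := by
      rcases le_or_gt 0 Y with hY0 | hY0
      · exact (Nat.floor_le hY0).trans hY
      · rw [Nat.floor_of_nonpos hY0.le, Nat.cast_zero]; linarith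
    have hB0 : (0 : ℝ) < B := by exact_mod_cast hB1
    calc ∑ m ∈ Icc 1 ⌊Y⌋₊, |tailLiouville x ρ m| ≤ (⌊Y⌋₊ : ℝ) / B := hmass
      _ ≤ 2 * x / (x ^ (60 * ρ) / 2) := by
          rw [div_le_div_iff₀ hB0 (by positivity)]
          have : 0 ≤ 2 * x := by linarith
          nlinarith
      _ = 4 * (x * x ^ (-(60 * ρ))) := by
          rw [Real.rpow_neg hx0.le]; field_simp; ring
      _ = 4 * x ^ (1 - 60 * ρ) := by
          rw [show (1 : ℝ) - 60 * ρ = 1 + -(60 * ρ) by ring, Real.rpow_add hx0, Real.rpow_one]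
      _ ≤ x ^ (7 * ρ) * x ^ (1 - 60 * ρ) := mul_le_mul_of_nonneg_right e1 (Real.rpow_nonneg hx0.le _)
      _ = x ^ (1 - 53 * ρ) := by rw [← Real.rpow_add hx0]; ring_nf
  · exact sum_filter_eq_le_sigma_pow (k := 1) (fun m => by rw [pow_one]; exact abs_tailLiouville_le x ρ m) Y

/-- Landing anchor of the `𝔲_R`-bound chain, file 2; registered stub `urbChain2_anchor` of the crux item (the
mathematical content of this file is `normSum_le_of_mass`, `urb_tail`). -/
theorem urbChain2_anchor : True := trivial

end Summit.Parity.GeneralizedHardyLittlewood.Cruxes.TypeI2Dilated.PeelToDrappeau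

end
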